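import Summits.BirchSwinnertonDyer.BirchSwinnertonDyer.Theorems.KolyvaginDepthDoorMSymbolCert446d1Twist23
import Summits.BirchSwinnertonDyer.BirchSwinnertonDyer.Theorems.KolyvaginDepthDoorDepthTableKuriharaRow389a1CertifiedT
import Summits.BirchSwinnertonDyer.BirchSwinnertonDyer.Theorems.KolyvaginDepthDoorDepthTableKuriharaRow446d1CertifiedE
import Summits.BirchSwinnertonDyer.BirchSwinnertonDyer.Theorems.KolyvaginDepthDoorDepthTableKuriharaDecisive446d1
import Literature.NumberTheory.EllipticCurves.BurungaleSkinnerTianWan2024.CyclotomicPConverseOverQProofs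
import HarnessLib

/-!
# Route `KolyvaginDepthDoor`, crux `KolyvaginDepthSupplyKN` (stmt-BirchSwinnertonDyer-22820) —
# DEPTH TABLE v28: the COMPOSITE-conductor row `446d1` @ `(7, −23)` with BOTH Kurihara claims PROVED (no computational claim)

Helper file of the lead prover of line `levelone` (kdd-p1 g33; `--supports stmt-BirchSwinnertonDyer-22820 --as helper`); it
closes nothing and BSD is NOT proved by it. First composite-conductor sibling of `…KuriharaRow997b1CertifiedT` (kits 1′–5′):
§1 the Kurihara data of `T₀ = 446d1 ⊗ χ₋₂₃` at `(7, 71)` (the `tc71` table of `…MSymbolCert446d1K`, the twisted minus sums `sigmaT` of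
`…MSymbolCert446d1Twist23`, `kSumT ≢ 0 (mod 7)`); §2 `exists_kuriharaNumber_ne_zero_T0` (|C|₇ = 1); §3 `C446d1.kuriharaClaimT_7_71` (the
hypothesis `hδT` of g24's socket `C446d1.cruxBody_of_twistKuriharaClaim_7_neg23` at `m = 71`) and `C446d1.cruxBody_of_print_7_neg23` — the
row with both claims discharged, conditional on the four print facts only.

References: [Kim2022StructureSelmer] Thm. 1.11, §1.4.3; [MazurTateTeitelbaum1986Invent] §I.8; [CremonaAlgorithms1997] §2.8, Table 1 (446d1);
[WZhang2014] L8.4 (1), Thm. 9.1; [Mazur1978] Cor. 4.1.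
-/

set_option linter.dupNamespace false

noncomputable section

open scoped MatrixGroups ModularForm Classical NumberField
open CongruenceSubgroup
open Literature.NumberTheory.EllipticCurves Literature.NumberTheory.EllipticCurves.ModularForms
open Literature.NumberTheory.EllipticCurves.BurungaleSkinnerTianWan2024
  (hasIrreducibleModPGaloisRep_of_smul_eq_quadraticTwist)
open Summit.BirchSwinnertonDyer.BirchSwinnertonDyer.Rank2Observatory
open Summit.BirchSwinnertonDyer.BirchSwinnertonDyer.Theorems.KolyvaginDepthDoor.MSymbolCert.Cert389a1
  (exists_mul_eq_half kuriharaNumber_ne_zero_of_const)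
open Summit.BirchSwinnertonDyer.BirchSwinnertonDyer.Theorems.KolyvaginDepthDoor (C446d1.minTwist23_isElliptic
  C446d1.minTwist23_isGloballyMinimal C446d1.minTwist23_intModel C446d1.minTwist23_smul_eq)

namespace Summit.BirchSwinnertonDyer.BirchSwinnertonDyer.Theorems.KolyvaginDepthDoor.MSymbolCert.Cert446d1

/-! ## §1 The Kurihara data of `T₀` at `(7, 71)` -/

/-- The table family for `n = 71` at the composite-level row (table `tc71` of `…MSymbolCert446d1K`). [folklore] -/
def Tw1633 (ℓ : ℕ) : List ℕ := if ℓ = 71 then tc71 else []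

/-- Admissibility of the table family. [folklore] -/
theorem Tw1633_ok : ∀ ℓ, Tw1633 ℓ = [] ∨ (ℓ.Prime ∧ tabOK ℓ 7 (Tw1633 ℓ) = true) := by
  intro ℓ
  by_cases h : ℓ = 71
  · right
    rw [h, Tw1633, if_pos rfl]
    exact ⟨by norm_num, tabOK_tc71⟩
  · left; simp [Tw1633, h]

/-- Surjectivity at the prime factors of `71`. [folklore] -/
theorem Tw1633_surj : ∀ ℓ ∈ (71 : ℕ).primeFactors, tabSurj ℓ 7 (Tw1633 ℓ) = true := by
  rw [show (71 : ℕ).primeFactors = {71} from Nat.Prime.primeFactors (by norm_num)]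
  intro ℓ hℓ
  rw [Finset.mem_singleton] at hℓ
  rw [hℓ, Tw1633, if_pos rfl]
  exact tabSurj_tc71

/-- The unit witness `sigmaT 2 = 3` (`7 ∤ 3`; decide). [folklore] -/
theorem sigmaT_witness : sigmaT 2 = 3 := by
  decide +kernel

/-- **The twisted Kurihara sum is `≢ 0 (mod 7)`** (decide: `≡ 2`). [cite: Kim2022StructureSelmer, §1.4.3] -/
theorem kSumT_ne_zero : kSum 7 71 sigmaT (71 : ℕ).primeFactors Tw1633 ≠ 0 := by
  rw [show (71 : ℕ).primeFactors = {71} from Nat.Prime.primeFactors (by norm_num), kSum, ← list_range_map_sum]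
  decide +kernel

/-! ## §2 The Kurihara number of the newform of `T₀` -/

/-- **`δ̃_{71}(T₀) ≢ 0 (mod 7)` from modularity of `446d1` by name.** [cite: Kim2022StructureSelmer, §1.4.3] [cite: MazurTateTeitelbaum1986Invent, §I.8] -/
theorem exists_kuriharaNumber_ne_zero_T0 (hnf : exists_isNewformOf) (N : ℕ) (hN : N = 235934) [NeZero N]
    (D : haveI := C446d1.minTwist23_isElliptic; ModularParametrizationData T0 N) :
    ∃ ψ : (ℓ : ℕ) → (ZMod ℓ)ˣ →* Multiplicative (ZMod 7),
      (∀ ℓ ∈ (71 : ℕ).primeFactors, Function.Surjective (ψ ℓ)) ∧ kuriharaNumber D.f 7 71 ψ ≠ 0 := by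
  subst hN
  haveI := C446d1.minTwist23_isElliptic
  haveI := C446d1.minTwist23_isGloballyMinimal
  haveI := isElliptic_c446d1
  haveI := isGloballyMinimal_c446d1
  haveI : Fact (Nat.Prime 7) := ⟨by norm_num⟩
  haveI : NeZero (71 : ℕ) := ⟨by norm_num⟩
  have hg := D.isNewformOf
  obtain ⟨C, hCall, hCval⟩ := exists_const_T0 hnf D.f hg
  obtain ⟨k, hk⟩ := exists_mul_eq_half D.f hg.1 hg.coeffField_eq_bot hCall
  have hirrE : (((⟨1, -1, 0, -4, 4⟩ : WeierstrassCurve ℤ).map (Int.castRingHom ℚ))).HasIrreducibleModPGaloisRep 7 :=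
    hasIrreducibleModPGaloisRep_of_hasSurjectiveModNGaloisRep _ 7 C446d1.hasSurjectiveModNGaloisRep_7
  have hirr : T0.HasIrreducibleModPGaloisRep 7 :=
    hasIrreducibleModPGaloisRep_of_smul_eq_quadraticTwist (((⟨1, -1, 0, -4, 4⟩ : WeierstrassCurve ℤ).map (Int.castRingHom ℚ))) T0 7 (d := -23) (by norm_num)
      C446d1.minTwist23_smul_eq hirrE
  have hle : ‖((ratPlusSymbol D.f (((2 : ℕ) : ℚ) / 71) : ℚ) : ℚ_[7])‖ ≤ 1 := by
    refine IsNewformOf.norm_ratPlusSymbol_le_one hg (by norm_num) hirr ?_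
    have hden : (((2 : ℕ) : ℚ) / 71).den = 71 := by norm_num
    rw [hden]; norm_num
  rw [hCval 2 (by norm_num) (by norm_num), sigmaT_witness] at hle
  have h2 : ‖(2 : ℚ_[7])‖ = 1 := by
    have := (Padic.norm_natCast_eq_one_iff (p := 7) (n := 2)).mpr (by norm_num)
    simpa using this
  have hv : ‖(((3 : ℤ) : ℚ) : ℚ_[7])‖ = 1 := by
    rw [Rat.cast_intCast]
    refine le_antisymm (Padic.norm_int_le_one _) (not_lt.mp fun hlt => ?_)
    exact absurd (Padic.norm_intCast_lt_one_iff.mp hlt) (by norm_num)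
  have hle' : ‖(C : ℚ_[7])‖ ≤ 1 := by
    have e : ((C * ((3 : ℤ) : ℚ) : ℚ) : ℚ_[7]) = (C : ℚ_[7]) * (((3 : ℤ) : ℚ) : ℚ_[7]) := by push_cast; ring
    rw [e, norm_mul, hv, mul_one] at hle
    exact hle
  have hk1 : ‖((k : ℤ) : ℚ_[7])‖ ≤ 1 := Padic.norm_int_le_one k
  have hprod : ‖(C : ℚ_[7])‖ * ‖((k : ℤ) : ℚ_[7])‖ = 1 := by
    have e : ((C * k : ℚ) : ℚ_[7]) = (C : ℚ_[7]) * ((k : ℤ) : ℚ_[7]) := by push_cast; ring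
    rw [← norm_mul, ← e, hk]
    push_cast
    rw [norm_div, norm_one, h2]; norm_num
  have hC7 : ‖(C : ℚ_[7])‖ = 1 := by
    apply le_antisymm hle'
    nlinarith [norm_nonneg (C : ℚ_[7]), norm_nonneg ((k : ℤ) : ℚ_[7])]
  have hCq : (C : ℚ_[7]) = ((C.num : ℤ) : ℚ_[7]) / ((C.den : ℕ) : ℚ_[7]) := by
    rw [← Rat.cast_intCast, ← Rat.cast_natCast, ← Rat.cast_div, Rat.num_div_den]
  have hdpos : 0 < ‖((C.den : ℕ) : ℚ_[7])‖ := norm_pos_iff.mpr (by exact_mod_cast C.den_ne_zero)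
  have hC7' : ‖((C.num : ℤ) : ℚ_[7])‖ = ‖((C.den : ℕ) : ℚ_[7])‖ := by
    rw [hCq, norm_div, div_eq_one_iff_eq hdpos.ne'] at hC7
    exact hC7
  have hden : ¬ 7 ∣ C.den := fun h => by
    have hlt : ‖((C.den : ℕ) : ℚ_[7])‖ < 1 := Padic.norm_natCast_lt_one_iff.mpr h
    have hnumlt : ‖((C.num : ℤ) : ℚ_[7])‖ < 1 := by rw [hC7']; exact hlt
    have h7num : (7 : ℤ) ∣ C.num := Padic.norm_intCast_lt_one_iff.mp hnumlt
    have hg7 : (7 : ℕ) ∣ Nat.gcd C.num.natAbs C.den := Nat.dvd_gcd (Int.natAbs_dvd_natAbs.mpr h7num) h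
    rw [C.reduced] at hg7
    omega
  have hnum : ¬ (7 : ℤ) ∣ C.num := fun h => by
    have hlt : ‖((C.num : ℤ) : ℚ_[7])‖ < 1 := Padic.norm_intCast_lt_one_iff.mpr h
    have hden1 : ‖((C.den : ℕ) : ℚ_[7])‖ = 1 :=
      Padic.norm_natCast_eq_one_iff.mpr ((Nat.Prime.coprime_iff_not_dvd (by norm_num)).mpr hden)
    rw [hden1] at hC7'
    linarith
  refine ⟨tabFamily 7 Tw1633 Tw1633_ok, fun ℓ hℓ =>
    surjective_tabFamily 7 Tw1633 Tw1633_ok (Nat.prime_of_mem_primeFactors hℓ) (Tw1633_surj ℓ hℓ), ?_⟩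
  exact kuriharaNumber_ne_zero_of_const D.f 7 71 (by norm_num) Tw1633 Tw1633_ok sigmaT C hnum hden
    (fun a ha hac => hCval a ha hac) kSumT_ne_zero

end Summit.BirchSwinnertonDyer.BirchSwinnertonDyer.Theorems.KolyvaginDepthDoor.MSymbolCert.Cert446d1

/-! ## §3 The row: both claims discharged -/

namespace Summit.BirchSwinnertonDyer.BirchSwinnertonDyer.Theorems.KolyvaginDepthDoor

open WeierstrassCurve NumberField IsDedekindDomain
open Summit.BirchSwinnertonDyer.BirchSwinnertonDyer.Theorems

namespace C446d1

/-- **THE TWIST-SIDE KURIHARA CLAIM OF ROW `446d1` @ `(7, −23)` FROM MODULARITY BY NAME** (claim for `T₀` @ `(7, 71)`, the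
hypothesis `hδT` of `cruxBody_of_twistKuriharaClaim_7_neg23` at `m = 71` VERBATIM). [cite: Kim2022StructureSelmer, §1.4.3] [cite: MazurTateTeitelbaum1986Invent, §I.8] -/
theorem kuriharaClaimT_7_71 (hnf : exists_isNewformOf) :
    haveI := minTwist23_isElliptic; haveI := minTwist23_isGloballyMinimal;
    haveI : NeZero ((((⟨1, -1, 0, -2215, -35567⟩ : WeierstrassCurve ℤ).map (Int.castRingHom ℚ))).conductorNorm ℤ) := neZero_conductorNorm_of_isElliptic _;
    haveI := Fact.mk (by norm_num : Nat.Prime 7);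
      ∀ (D : ModularParametrizationData (((⟨1, -1, 0, -2215, -35567⟩ : WeierstrassCurve ℤ).map (Int.castRingHom ℚ))) ((((⟨1, -1, 0, -2215, -35567⟩ : WeierstrassCurve ℤ).map (Int.castRingHom ℚ))).conductorNorm ℤ)),
      ¬ ((7 : ℕ) : ℤ) ∣ D.maninConstant →
      (∃ u : ℚ, ‖(u : ℚ_[7])‖ = 1 ∧ (((⟨1, -1, 0, -2215, -35567⟩ : WeierstrassCurve ℤ).map (Int.castRingHom ℚ))).realPeriodRat = u * plusPeriod D.f) →
      ∃ ψ : (ℓ : ℕ) → (ZMod ℓ)ˣ →* Multiplicative (ZMod 7),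
        (∀ ℓ ∈ (71 : ℕ).primeFactors, Function.Surjective (ψ ℓ)) ∧ kuriharaNumber D.f 7 71 ψ ≠ 0 := by
  intro D _ _
  haveI := minTwist23_isElliptic
  haveI : NeZero ((((⟨1, -1, 0, -2215, -35567⟩ : WeierstrassCurve ℤ).map (Int.castRingHom ℚ))).conductorNorm ℤ) := neZero_conductorNorm_of_isElliptic _
  exact MSymbolCert.Cert446d1.exists_kuriharaNumber_ne_zero_T0 hnf _ MSymbolCert.Cert446d1.conductorNorm_T0 D

/-- **DEPTH-TABLE ROW `446d1` (COMPOSITE CONDUCTOR `2·223`), `(p, d_K) = (7, −23)`, v28 — NO COMPUTATIONAL CLAIM LEFT.** For every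
imaginary quadratic `K` with `d_K = −23`: granted Kim's Thm. 1.11 (`hKim`), modularity (`hnf`), Mazur's Cor. 4.1 (`hMaz`), W. Zhang's
L8.4 (1)/9.1 (`h84`) BY NAME, the clause of the crux `KolyvaginDepthSupplyKN` holds at `W = 446d1` VERBATIM — g24's socket
`cruxBody_of_twistKuriharaClaim_7_neg23` at the cyclic Kolyvagin level `m = 71` with BOTH claims PROVED (`kuriharaClaim_7_8023`: the pair-indexed
certified plus M-symbol at level `446`; `kuriharaClaimT_7_71`: certified minus M-symbol and the twist formula). CONDITIONAL on the four named
print facts ONLY; per curve; nothing class-wide; BSD is not proved by it. [cite: Kim2022StructureSelmer, Thm. 1.11 (PDF p. 8)]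
[cite: WZhang2014, Lemma 8.4 (1) (p. 236), Thm. 9.1 (p. 240)] [cite: Mazur1978, Cor. 4.1] [cite: CremonaAlgorithms1997, Table 1 (446d1)] -/
theorem cruxBody_of_print_7_neg23
    (hKim : Kim2022_card_selmerGroup_le_pow_of_kuriharaNumber_ne_zero)
    (hnf : exists_isNewformOf) (hMaz : mazur_not_dvd_maninConstant_of_odd)
    (h84 : Literature.NumberTheory.EllipticCurves.WZhang2014_lemma84_exists_minimal_kolyvaginClass_one_selmerCard)
    (K : Type) [Field K] [NumberField K] (hK : IsImaginaryQuadratic K) (hD : NumberField.discr K = -23) :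
    haveI := isElliptic_c446d1; haveI := isGloballyMinimal_c446d1;
    ∃ (p : ℕ) (hp : Fact p.Prime), 5 ≤ p ∧ (((⟨1, -1, 0, -4, 4⟩ : WeierstrassCurve ℤ).map (Int.castRingHom ℚ))).HasGoodReductionAtPrime p ∧
      ¬ (p : ℤ) ∣ (((⟨1, -1, 0, -4, 4⟩ : WeierstrassCurve ℤ).map (Int.castRingHom ℚ))).frobeniusTrace p ∧
      (∀ n : ℕ, (((⟨1, -1, 0, -4, 4⟩ : WeierstrassCurve ℤ).map (Int.castRingHom ℚ))).HasSurjectiveModNGaloisRep (p ^ n : ℕ)) ∧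
      (∀ v : HeightOneSpectrum (𝓞 ℚ), (((⟨1, -1, 0, -4, 4⟩ : WeierstrassCurve ℤ).map (Int.castRingHom ℚ))).HasMultiplicativeReductionAt v →
        ¬ p ∣ (((⟨1, -1, 0, -4, 4⟩ : WeierstrassCurve ℤ).map (Int.castRingHom ℚ))).ordMinimalDiscriminant v) ∧
      ∃ (K : Type) (_ : Field K) (_ : NumberField K), IsImaginaryQuadratic K ∧
        NumberField.discr K ≠ -3 ∧ NumberField.discr K ≠ -4 ∧
        ∃ (_ : NeZero ((((⟨1, -1, 0, -4, 4⟩ : WeierstrassCurve ℤ).map (Int.castRingHom ℚ))).conductorNorm ℤ)),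
          SatisfiesHeegnerHypothesis ((((⟨1, -1, 0, -4, 4⟩ : WeierstrassCurve ℤ).map (Int.castRingHom ℚ))).conductorNorm ℤ) K ∧
        ∃ (Dt : ModularParametrizationData (((⟨1, -1, 0, -4, 4⟩ : WeierstrassCurve ℤ).map (Int.castRingHom ℚ))) ((((⟨1, -1, 0, -4, 4⟩ : WeierstrassCurve ℤ).map (Int.castRingHom ℚ))).conductorNorm ℤ))
          (β : ℤ) (ι : K →+* ℂ) (n₁ : ℕ) (d : KolyvaginHeegnerData Dt β ι n₁), Squarefree n₁ ∧
          (∀ q ∈ n₁.primeFactors, Zhang2014.IsKolyvaginPrime ((((⟨1, -1, 0, -4, 4⟩ : WeierstrassCurve ℤ).map (Int.castRingHom ℚ))).conductorNorm ℤ)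
            (((⟨1, -1, 0, -4, 4⟩ : WeierstrassCurve ℤ).map (Int.castRingHom ℚ))) K p q) ∧
          d.kolyvaginClass hp.out 1 ≠ 0 ∧
          (n₁.primeFactors.card + 1 ≤ (((⟨1, -1, 0, -4, 4⟩ : WeierstrassCurve ℤ).map (Int.castRingHom ℚ))).mordellWeilRank ∨
            (n₁.primeFactors.card ≤ (((⟨1, -1, 0, -4, 4⟩ : WeierstrassCurve ℤ).map (Int.castRingHom ℚ))).mordellWeilRank ∧
              n₁.primeFactors.card + 1 ≤ ((((⟨1, -1, 0, -4, 4⟩ : WeierstrassCurve ℤ).map (Int.castRingHom ℚ))).quadraticTwist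
                (NumberField.discr K : ℚ)).mordellWeilRank)) := by
  haveI := minTwist23_isElliptic
  haveI := minTwist23_isGloballyMinimal
  haveI : Fact (Nat.Prime 71) := ⟨by norm_num⟩
  haveI : NeZero (71 : ℕ) := ⟨by norm_num⟩
  exact cruxBody_of_twistKuriharaClaim_7_neg23 hKim hnf hMaz h84 K hK hD kuriharaClaim_7_8023 71
    minTwist23_isCyclicKolyvaginLevel_7_71 (by rw [Nat.Prime.primeFactors (by norm_num), Finset.card_singleton]; norm_num)
    (kuriharaClaimT_7_71 hnf)

end C446d1

end Summit.BirchSwinnertonDyer.BirchSwinnertonDyer.Theorems.KolyvaginDepthDoor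

end
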